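import Summits.NavierStokesRegularity.NavierStokesRegularity.Theorems.ExtremiserTransienceDissipationLedgerMeasureGlue
import Summits.NavierStokesRegularity.NavierStokesRegularity.Theorems.ExtremiserTransienceDissipationLedgerPressureFlux
import Summits.NavierStokesRegularity.NavierStokesRegularity.Theorems.ExtremiserTransienceDissipationLedgerDefs
import Literature.Analysis.FluidPDE.TypeIAncientMildClassical
import Literature.Analysis.FluidPDE.MildAncientTimeDecayRegularity
import Literature.Analysis.FluidPDE.OseenMildPressureIdentification
import Literature.Analysis.FluidPDE.TsaiLocalPressureSup
import Literature.Analysis.FluidPDE.ClassicalLocalEnergyNoJump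
import Literature.Analysis.FluidPDE.MildSolutionProofs
import Literature.Analysis.FluidPDE.LeraySeparationOfEnergyTools
import Literature.Analysis.Calculus.DifferenceQuotientHolder
import HarnessLib

/-!
# Dissipation ledger (LINE g10-α, crux 26567), stub L1 — the dissipation budget of the UNIT parabolic cylinder

Helper file for the registered stub `stub_dissipationBudget` (L1 `DissipationBudget`) of LINE g10-α `dissipation_ledger`
(crux `NearExtremalTransiencePerFlow`, stmt-NavierStokesRegularity-26567).  For a Type-I ancient mild field `W` (`IsTypeIAncientMild K W`)
with all-time linear local-energy growth `A` (`HasLinGrowthAllTime A W`), the space–time dissipation of the unit parabolic cylinder about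
the origin is bounded:

  `dissMeasure W ([τ₁, τ₂] × B(0,1)) ≤ C_u · (A + K·A + A·√A)`   for `τ₁ < τ₂ < 0`, `−τ₁ ≤ 1`   (`dissipation_unitCylinder_le`).

Proof = the local energy identity of the classical windows of `W` (tree `IsTypeIAncientMild.exists_isClassicalNSSolutionOn_Ioo`,
`IsClassicalNSSolutionOn.local_energy_identity_cutoff`, `…integral_flux_le`) with the cut-off `χ₁` (`1` on `B(0,1)`, support in
`B̄(0,2)`): the initial energy `∫χ₁|W(τ₁)|² ≤ 3A`, the `Δχ₁`-term `≤ 3C₂A` per unit time, the cubic flux `≤ 3C₁·(K/√(−s))·A`, and the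
pressure flux — in the Riesz gauge `q(s) = pressurePotentialMod 0 (W s) + c(s)` of every classical pressure of a bounded Oseen-mild window
(`pressure_gauge_typeIAncientMild`, from the tree's `pressure_eq_pressurePotentialMod_add_const_of_oseenMild`) —
`≤ 2 C_P C₁ ((K/√(−s)) A + A√A)` (`pressureFlux_slice_le` of the sibling file).  The only time-singular factor is `(−s)^{−1/2}`, which
integrates to `2(√(−τ₁) − √(−τ₂)) ≤ 2`: NO logarithm.  The last section converts the Bochner double integral of the identity into the
`withDensity` measure `dissMeasure` of the line (operator norm `≤` Frobenius norm, Tonelli).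

HONEST FRAMING: local energy bookkeeping for hypothetical Type-I ancient fields; nothing about Navier–Stokes regularity or blow-up is
proved; no summit is proved by a line. [cite: CaffarelliKohnNirenberg1982, §2 (2.5); KochNadirashviliSereginSverak2009, §4 p. 8]
-/

noncomputable section

open MeasureTheory Set Filter Metric Topology Function
open scoped ENNReal NNReal Laplacian InnerProductSpace

namespace Summit.NavierStokesRegularity.NavierStokesRegularity.Theorems

set_option linter.dupNamespace false

namespace NearExtremalTransiencePerFlow.DissipationLedger

open Literature.Analysis Literature.Analysis.FluidPDE

-- nested operator types
set_option maxSynthPendingDepth 3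

/-! ### The Riesz gauge of the classical pressure of a Type-I ancient mild window -/

/-- **Every classical pressure of a Type-I ancient mild field is, at each time, the Riesz pressure modulo a constant**: if `(W, q)` is a
classical solution on a window `(a, 0)` and `s < 0` with `a < 9s/8`, then `q(s,·) = pressurePotentialMod 0 (W s) + c` for some constant
`c` — KNSS Prop. 4.1 bounds `∇W, ∇²W` (hence the quadratic source) on `(9s/8, 7s/8)` (tree
`exists_norm_iteratedFDeriv_le_window_of_hasTypeITimeDecay`), and the tree's identification `pressure_eq_pressurePotentialMod_add_const_of_oseenMild`
applies on that window. [cite: KochNadirashviliSereginSverak2009, §4 Prop. 4.1 (arXiv:0709.3599 p. 8); Seregin2014, §6.3 Def. 6.3] -/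
theorem pressure_gauge_typeIAncientMild {K : ℝ} {W : ℝ → EuclideanSpace ℝ (Fin 3) → EuclideanSpace ℝ (Fin 3)}
    {q : ℝ → EuclideanSpace ℝ (Fin 3) → ℝ} (hW : IsTypeIAncientMild K W) {a : ℝ}
    (hcl : IsClassicalNSSolutionOn (Ioo a 0) 1 0 W q) {s : ℝ} (hs : s < 0) (has : a < 9 * s / 8) :
    ∃ c : ℝ, ∀ x, q s x = pressurePotentialMod 0 (W s) x + c := by
  -- adapted from the discharge `MildAncientPressureLogGrowth_holds` (Literature/…/MildBoundedAncientPressureBMO.lean)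
  have hK0 : 0 ≤ K := hW.nonneg
  have hdec : HasTypeITimeDecay K W := hW.hasTypeITimeDecay
  have hcont : ContinuousOn (uncurry W) (Iio (0 : ℝ) ×ˢ univ) := hW.continuousOn_uncurry
  have hmild : ∀ s' t : ℝ, s' < t → t < 0 → ∀ x,
      W t x = UnboundedOperators.heatExtension (W s') (t - s') x - oseenDuhamel 1 s' W W t x :=
    fun s' t hst ht x => hW.mild_eq_heatExtension hst ht x
  have hwdiv : ∀ t < 0, IsWeaklyDivFree (W t) := fun t ht => hW.isWeaklyDivFree ht
  -- the window
  set t₁ : ℝ := 9 * s / 8 with ht₁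
  set t₂ : ℝ := 7 * s / 8 with ht₂
  have ht₂0 : t₂ < 0 := by rw [ht₂]; linarith
  have hsI : s ∈ Ioo t₁ t₂ := by rw [ht₁, ht₂]; constructor <;> linarith
  have hIsub : Ioo t₁ t₂ ⊆ Ioo a 0 := fun σ hσ => ⟨has.trans hσ.1, hσ.2.trans ht₂0⟩
  have hIsub0 : Ioo t₁ t₂ ⊆ Iio (0 : ℝ) := fun σ hσ => hσ.2.trans ht₂0
  -- velocity bound on the window
  set N : ℝ := K / Real.sqrt (-t₂) with hN
  have hNb : ∀ σ ∈ Ioo t₁ t₂, ∀ x, ‖W σ x‖ ≤ N := fun σ hσ x => hW.norm_le_of_mem_Ioo ht₂0 hσ x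
  -- derivative bounds on the window
  obtain ⟨K₁, hK₁⟩ := exists_norm_iteratedFDeriv_le_window_of_hasTypeITimeDecay hdec hcont hmild hwdiv hs 1
  obtain ⟨K₂, hK₂⟩ := exists_norm_iteratedFDeriv_le_window_of_hasTypeITimeDecay hdec hcont hmild hwdiv hs 2
  -- the quadratic source is bounded on the window
  set T : ℝ := ‖(traceCLM : (EuclideanSpace ℝ (Fin 3) →L[ℝ] EuclideanSpace ℝ (Fin 3)) →L[ℝ] ℝ)‖ with hT
  set NG : ℝ := 2 * T * K₂ * N + (T + T ^ 2) * K₁ ^ 2 with hNG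
  have hG : ∀ σ ∈ Ioo t₁ t₂, ∀ x, |pressureSource (W σ) x| ≤ NG := by
    intro σ hσ x
    have hσ0 : σ < 0 := hIsub0 hσ
    have hcd : ContDiff ℝ 2 (W σ) := contDiff_infty.1 (hW.contDiff_slice hσ0) 2
    have h := abs_pressureSource_le hcd x
    have hD1 : ‖fderiv ℝ (W σ) x‖ ≤ K₁ := by
      rw [← norm_iteratedFDeriv_one]; exact hK₁ σ hσ x
    have hD2 : ‖fderiv ℝ (fderiv ℝ (W σ)) x‖ ≤ K₂ :=
      (Literature.Analysis.Calculus.norm_fderiv_fderiv_le_norm_iteratedFDeriv_two (W σ) x).trans (hK₂ σ hσ x)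
    have hv := hNb σ hσ x
    have hT0 : 0 ≤ T := norm_nonneg _
    have hK₂0 : 0 ≤ K₂ := (norm_nonneg _).trans hD2
    have A1 : 2 * T * ‖fderiv ℝ (fderiv ℝ (W σ)) x‖ * ‖W σ x‖ ≤ 2 * T * K₂ * N := by
      have h1 : 2 * T * ‖fderiv ℝ (fderiv ℝ (W σ)) x‖ ≤ 2 * T * K₂ :=
        mul_le_mul_of_nonneg_left hD2 (by positivity)
      exact mul_le_mul h1 hv (norm_nonneg _) (by positivity)
    have A2 : (T + T ^ 2) * ‖fderiv ℝ (W σ) x‖ ^ 2 ≤ (T + T ^ 2) * K₁ ^ 2 :=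
      mul_le_mul_of_nonneg_left (pow_le_pow_left₀ (norm_nonneg _) hD1 2) (by positivity)
    rw [hNG]
    exact h.trans (add_le_add A1 A2)
  -- Oseen-mild and classical on the window
  have hmildW : ∀ s' ∈ Ioo t₁ t₂, ∀ t' ∈ Ioo t₁ t₂, s' < t' → ∀ x,
      W t' x = UnboundedOperators.heatExtension (W s') (t' - s') x - oseenDuhamel 1 s' W W t' x :=
    fun s' _ t' ht' hst x => hmild s' t' hst (hIsub0 ht') x
  have hclW : IsClassicalNSSolutionOn (Ioo t₁ t₂) 1 0 W q := hcl.mono hIsub (uniqueDiffOn_Ioo t₁ t₂)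
  exact PressureNormalisation.pressure_eq_pressurePotentialMod_add_const_of_oseenMild hclW hNb hG hmildW 0 hsI

/-! ### The flux of one slice -/

/-- **The flux of the local energy identity at one time is `≤ a + b/√(−s)`.**  For a classical window `(W, q)` of a Type-I ancient mild
field with growth `A` at time `s` (about the origin) and the sup bound `‖W s‖ ≤ N`, with the cut-off `χ₁` (`‖Dχ₁‖ ≤ C₁`, `|Δχ₁| ≤ C₂`)
and the pressure-flux constant `C_P` of `pressureFlux_slice_le`:
`flux(s) ≤ 3C₂A + 3C₁NA + 2C_P C₁ (NA + A√A)`. [cite: CaffarelliKohnNirenberg1982, §2 (2.5)] -/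
theorem flux_slice_le {S : Set ℝ} {W : ℝ → EuclideanSpace ℝ (Fin 3) → EuclideanSpace ℝ (Fin 3)}
    {q : ℝ → EuclideanSpace ℝ (Fin 3) → ℝ} (hcl : IsClassicalNSSolutionOn S 1 0 W q) {s : ℝ} (hs : s ∈ S)
    (hsm : ContDiff ℝ (⊤ : ℕ∞) (W s)) {c : ℝ} (hgauge : ∀ x, q s x = pressurePotentialMod 0 (W s) x + c)
    {N A : ℝ} (hN : ∀ x, ‖W s x‖ ≤ N)
    (hA : ∀ R : ℝ, 0 < R → ∫ z in ball (0 : EuclideanSpace ℝ (Fin 3)) R, ‖W s z‖ ^ 2 ≤ A * R)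
    {C₁ C₂ C_P : ℝ} (hC₁ : ∀ x, ‖fderiv ℝ (cutoff (1 : ℝ) : EuclideanSpace ℝ (Fin 3) → ℝ) x‖ ≤ C₁)
    (hC₂ : ∀ x, |(Δ (cutoff (1 : ℝ) : EuclideanSpace ℝ (Fin 3) → ℝ)) x| ≤ C₂)
    (hCP : ∀ (v : EuclideanSpace ℝ (Fin 3) → EuclideanSpace ℝ (Fin 3)), ContDiff ℝ (⊤ : ℕ∞) v →
      ∀ (N' A' : ℝ), (∀ y, ‖v y‖ ≤ N') →
      (∀ R : ℝ, 0 < R → ∫ z in ball (0 : EuclideanSpace ℝ (Fin 3)) R, ‖v z‖ ^ 2 ≤ A' * R) →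
      ∀ (φ : EuclideanSpace ℝ (Fin 3) → ℝ) (Cφ : ℝ), tsupport φ ⊆ closedBall (0 : EuclideanSpace ℝ (Fin 3)) 2 →
      (∀ x, ‖fderiv ℝ φ x‖ ≤ Cφ) →
        ∫ x, |pressurePotentialMod 0 v x| * ‖fderiv ℝ φ x‖ * ‖v x‖ ≤ C_P * Cφ * (N' * A' + A' * Real.sqrt A')) :
    ∫ x, ((1 : ℝ) * ((Δ (cutoff (1 : ℝ) : EuclideanSpace ℝ (Fin 3) → ℝ)) x * ‖W s x‖ ^ 2) +
        fderiv ℝ (cutoff (1 : ℝ) : EuclideanSpace ℝ (Fin 3) → ℝ) x (W s x) * ‖W s x‖ ^ 2 +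
        2 * (q s x * fderiv ℝ (cutoff (1 : ℝ) : EuclideanSpace ℝ (Fin 3) → ℝ) x (W s x))) ≤
      3 * C₂ * A + 3 * C₁ * N * A + 2 * (C_P * C₁ * (N * A + A * Real.sqrt A)) := by
  set φ : EuclideanSpace ℝ (Fin 3) → ℝ := cutoff (1 : ℝ) with hφ
  have hφs : tsupport φ ⊆ closedBall (0 : EuclideanSpace ℝ (Fin 3)) 2 := tsupport_cutoff_one_subset_closedBall_two
  have hvc : Continuous (W s) := hsm.continuous
  have hN0 : 0 ≤ N := (norm_nonneg _).trans (hN 0)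
  have hC₁0 : 0 ≤ C₁ := (norm_nonneg _).trans (hC₁ 0)
  have hA3 : ∫ z in ball (0 : EuclideanSpace ℝ (Fin 3)) 3, ‖W s z‖ ^ 2 ≤ A * 3 := hA 3 (by norm_num)
  have hflux := hcl.integral_flux_le (contDiff_cutoff 1) (hasCompactSupport_cutoff one_pos) hs c
  -- term 1: `|ν| ∫ |Δφ| |W|² ≤ 3 C₂ A`
  have hT1 : ∫ x, |(Δ φ) x| * ‖W s x‖ ^ 2 ≤ C₂ * (A * 3) := by
    have hΔs : tsupport (Δ φ) ⊆ closedBall (0 : EuclideanSpace ℝ (Fin 3)) 2 := by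
      refine (closure_minimal (fun x hx => ?_) (isClosed_tsupport _)).trans hφs
      by_contra h
      exact hx (laplacian_eq_zero_of_notMem_tsupport h)
    exact (integral_mul_norm_sq_le_of_tsupport hΔs hC₂ hvc).trans (mul_le_mul_of_nonneg_left hA3 ((abs_nonneg _).trans (hC₂ 0)))
  -- term 2: `∫ ‖Dφ‖ |W|³ ≤ 3 C₁ N A`
  have hT2 : ∫ x, ‖fderiv ℝ φ x‖ * ‖W s x‖ ^ 3 ≤ C₁ * N * (A * 3) := by
    have hDs : tsupport (fun x => ‖fderiv ℝ φ x‖ * ‖W s x‖) ⊆ closedBall (0 : EuclideanSpace ℝ (Fin 3)) 2 := by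
      refine (closure_minimal (fun x hx => ?_) (isClosed_tsupport _)).trans hφs
      by_contra h
      have h0 : ‖fderiv ℝ φ x‖ * ‖W s x‖ = 0 := by rw [fderiv_of_notMem_tsupport ℝ h, norm_zero, zero_mul]
      exact hx h0
    have hbd : ∀ x, |‖fderiv ℝ φ x‖ * ‖W s x‖| ≤ C₁ * N := fun x => by
      rw [abs_of_nonneg (by positivity)]
      exact mul_le_mul (hC₁ x) (hN x) (norm_nonneg _) hC₁0
    have h := integral_mul_norm_sq_le_of_tsupport hDs hbd hvc
    have e : (fun x => |‖fderiv ℝ φ x‖ * ‖W s x‖| * ‖W s x‖ ^ 2) = fun x => ‖fderiv ℝ φ x‖ * ‖W s x‖ ^ 3 := by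
      funext x; rw [abs_of_nonneg (by positivity)]; ring
    rw [e] at h
    exact h.trans (mul_le_mul_of_nonneg_left hA3 (by positivity))
  -- term 3: the pressure flux in the Riesz gauge
  have hT3 : ∫ x, |q s x - c| * ‖fderiv ℝ φ x‖ * ‖W s x‖ ≤ C_P * C₁ * (N * A + A * Real.sqrt A) := by
    have e : (fun x => |q s x - c| * ‖fderiv ℝ φ x‖ * ‖W s x‖) =
        fun x => |pressurePotentialMod 0 (W s) x| * ‖fderiv ℝ φ x‖ * ‖W s x‖ := by
      funext x; rw [hgauge x, add_sub_cancel_right]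
    rw [e]
    exact hCP (W s) hsm N A hN hA φ C₁ hφs hC₁
  calc ∫ x, ((1 : ℝ) * ((Δ φ) x * ‖W s x‖ ^ 2) + fderiv ℝ φ x (W s x) * ‖W s x‖ ^ 2 + 2 * (q s x * fderiv ℝ φ x (W s x)))
      ≤ |(1 : ℝ)| * (∫ x, |(Δ φ) x| * ‖W s x‖ ^ 2) + (∫ x, ‖fderiv ℝ φ x‖ * ‖W s x‖ ^ 3) +
          2 * ∫ x, |q s x - c| * ‖fderiv ℝ φ x‖ * ‖W s x‖ := hflux
    _ ≤ 1 * (C₂ * (A * 3)) + C₁ * N * (A * 3) + 2 * (C_P * C₁ * (N * A + A * Real.sqrt A)) := by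
        rw [abs_one]; gcongr
    _ = 3 * C₂ * A + 3 * C₁ * N * A + 2 * (C_P * C₁ * (N * A + A * Real.sqrt A)) := by ring

/-! ### The budget of the unit cylinder -/

/-- **The localised dissipation of the unit window is bounded by the budget** (L1 at unit scale about the origin, Bochner form): there is
an absolute `C_u ≥ 0` such that for every Type-I ancient mild field `W` (constant `K`) with all-time linear growth `A` and all
`τ₁ < τ₂ < 0` with `−τ₁ ≤ 1`, `∫_{τ₁}^{τ₂} ∫ |∇W|²_F χ₁ ≤ C_u (A + K A + A√A)`.  Local energy identity with `χ₁` on the classical window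
`((2τ₁−1), 0)`; initial energy `≤ 3A`; flux `≤ a + b/√(−s)` (`flux_slice_le`) integrated with `∫ ds/√(−s) ≤ 2`; no logarithm.
[cite: CaffarelliKohnNirenberg1982, §2 (2.5); KochNadirashviliSereginSverak2009, §4 p. 8] -/
theorem unitCylinder_dissipationIntegral_le :
    ∃ C_u : ℝ, 0 ≤ C_u ∧ ∀ (K A : ℝ) (W : ℝ → EuclideanSpace ℝ (Fin 3) → EuclideanSpace ℝ (Fin 3)),
      IsTypeIAncientMild K W → HasLinGrowthAllTime A W →
      ∀ τ₁ τ₂ : ℝ, τ₁ < τ₂ → τ₂ < 0 → -τ₁ ≤ 1 →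
        ∫ s in τ₁..τ₂, ∫ x, frobeniusNormSq (fderiv ℝ (W s) x) * (cutoff (1 : ℝ) : EuclideanSpace ℝ (Fin 3) → ℝ) x ≤
          C_u * (A + K * A + A * Real.sqrt A) := by
  -- the constants of the unit cut-off and of the pressure flux
  obtain ⟨C₁', hC₁'0, hC₁'⟩ := exists_norm_fderiv_cutoff_le (E := EuclideanSpace ℝ (Fin 3))
  obtain ⟨C₂', hC₂'0, hC₂'⟩ := exists_abs_laplacian_cutoff_le (E := EuclideanSpace ℝ (Fin 3))
  obtain ⟨C_P, hCP0, hCP⟩ := pressureFlux_slice_le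
  set C₁ : ℝ := C₁' / 1 with hC₁
  set C₂ : ℝ := C₂' / 1 ^ 2 with hC₂
  have hC₁b : ∀ x, ‖fderiv ℝ (cutoff (1 : ℝ) : EuclideanSpace ℝ (Fin 3) → ℝ) x‖ ≤ C₁ := fun x => hC₁' 1 one_pos x
  have hC₂b : ∀ x, |(Δ (cutoff (1 : ℝ) : EuclideanSpace ℝ (Fin 3) → ℝ)) x| ≤ C₂ := fun x => hC₂' 1 one_pos x
  have hC₁0 : 0 ≤ C₁ := by rw [hC₁]; positivity
  have hC₂0 : 0 ≤ C₂ := by rw [hC₂]; positivity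
  -- `2·budget ≤ 3A + a + 2b` with `a = 3C₂A + 2C_P C₁ A√A`, `b = (3C₁ + 2C_P C₁) K A`; take `C_u` covering all three
  refine ⟨(3 + 3 * C₂ + 2 * C_P * C₁ + 2 * (3 * C₁ + 2 * C_P * C₁)) / 2, by positivity, ?_⟩
  intro K A W hW hgr τ₁ τ₂ h12 h2 h1
  have hK0 : 0 ≤ K := hW.nonneg
  have hA0 : 0 ≤ A := by
    have h := hgr (-1) (by norm_num) 0 1 one_pos
    have h0 : 0 ≤ ∫ z in ball (0 : EuclideanSpace ℝ (Fin 3)) 1, ‖W (-1) z‖ ^ 2 := integral_nonneg fun z => sq_nonneg _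
    linarith
  have hsA0 : 0 ≤ Real.sqrt A := Real.sqrt_nonneg _
  -- cut-off
  set φ : EuclideanSpace ℝ (Fin 3) → ℝ := cutoff (1 : ℝ) with hφdef
  have hφ : ContDiff ℝ (⊤ : ℕ∞) φ := contDiff_cutoff 1
  have hφcs : HasCompactSupport φ := hasCompactSupport_cutoff one_pos
  have hφs : tsupport φ ⊆ closedBall (0 : EuclideanSpace ℝ (Fin 3)) 2 := tsupport_cutoff_one_subset_closedBall_two
  -- the classical window
  set a₀ : ℝ := 2 * τ₁ - 1 with ha₀
  have ha₀0 : a₀ < 0 := by rw [ha₀]; linarith [h12.trans h2]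
  obtain ⟨q, hcl⟩ := hW.exists_isClassicalNSSolutionOn_Ioo (t₀ := a₀) ha₀0
  have hI : Icc τ₁ τ₂ ⊆ Ioo a₀ 0 := fun s hs => ⟨by rw [ha₀]; linarith [hs.1, h12.trans h2], hs.2.trans_lt h2⟩
  -- the local energy identity
  have hid := hcl.local_energy_identity_cutoff isOpen_Ioo hφ hφcs h12.le hI
  -- the constants `a`, `b`
  set a : ℝ := 3 * C₂ * A + 2 * (C_P * C₁ * (A * Real.sqrt A)) with ha
  set b : ℝ := (3 * C₁ + 2 * (C_P * C₁)) * (K * A) with hb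
  have ha_nn : 0 ≤ a := by rw [ha]; positivity
  have hb_nn : 0 ≤ b := by rw [hb]; positivity
  -- per-slice flux bound on `[τ₁, τ₂]`
  have hflux : ∀ s ∈ Icc τ₁ τ₂,
      ∫ x, ((1 : ℝ) * ((Δ φ) x * ‖W s x‖ ^ 2) + fderiv ℝ φ x (W s x) * ‖W s x‖ ^ 2 + 2 * (q s x * fderiv ℝ φ x (W s x))) ≤
        a + b * (Real.sqrt (-s))⁻¹ := by
    intro s hs
    have hs0 : s < 0 := hs.2.trans_lt h2
    have has : a₀ < 9 * s / 8 := by rw [ha₀]; linarith [hs.1]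
    obtain ⟨c, hc⟩ := pressure_gauge_typeIAncientMild hW hcl hs0 has
    set N : ℝ := K / Real.sqrt (-s) with hN
    have hNb : ∀ x, ‖W s x‖ ≤ N := fun x => hW.norm_le hs0 x
    have hAs : ∀ R : ℝ, 0 < R → ∫ z in ball (0 : EuclideanSpace ℝ (Fin 3)) R, ‖W s z‖ ^ 2 ≤ A * R :=
      fun R hR => hgr s hs0 0 R hR
    have h := flux_slice_le hcl (hI hs) (hW.contDiff_slice hs0) hc hNb hAs hC₁b hC₂b hCP
    refine h.trans (le_of_eq ?_)
    rw [ha, hb, hN]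
    field_simp
    ring
  -- time integration of the flux bound
  have hfluxI : IntervalIntegrable (fun s => ∫ x, ((1 : ℝ) * ((Δ φ) x * ‖W s x‖ ^ 2) +
      fderiv ℝ φ x (W s x) * ‖W s x‖ ^ 2 + 2 * (q s x * fderiv ℝ φ x (W s x)))) volume τ₁ τ₂ := by
    refine ((hcl.continuousOn_integral_flux_cutoff hφ hφcs).mono ?_).intervalIntegrable
    rw [uIcc_of_le h12.le]; exact hI
  have hinvc : ContinuousOn (fun s : ℝ => (Real.sqrt (-s))⁻¹) (uIcc τ₁ τ₂) := by
    refine ContinuousOn.inv₀ (by fun_prop) fun s hs => ?_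
    rw [uIcc_of_le h12.le] at hs
    exact (Real.sqrt_pos.2 (by linarith [hs.2, h2])).ne'
  have hbI : IntervalIntegrable (fun s => b * (Real.sqrt (-s))⁻¹) volume τ₁ τ₂ :=
    (continuousOn_const.mul hinvc).intervalIntegrable
  have hbdI : IntervalIntegrable (fun s => a + b * (Real.sqrt (-s))⁻¹) volume τ₁ τ₂ :=
    intervalIntegrable_const.add hbI
  have hint_le : ∫ s in τ₁..τ₂, (∫ x, ((1 : ℝ) * ((Δ φ) x * ‖W s x‖ ^ 2) +
      fderiv ℝ φ x (W s x) * ‖W s x‖ ^ 2 + 2 * (q s x * fderiv ℝ φ x (W s x)))) ≤ a + 2 * b := by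
    calc ∫ s in τ₁..τ₂, (∫ x, ((1 : ℝ) * ((Δ φ) x * ‖W s x‖ ^ 2) +
          fderiv ℝ φ x (W s x) * ‖W s x‖ ^ 2 + 2 * (q s x * fderiv ℝ φ x (W s x))))
        ≤ ∫ s in τ₁..τ₂, (a + b * (Real.sqrt (-s))⁻¹) :=
          intervalIntegral.integral_mono_on h12.le hfluxI hbdI hflux
      _ = a * (τ₂ - τ₁) + b * (2 * (Real.sqrt (-τ₁) - Real.sqrt (-τ₂))) := by
          rw [intervalIntegral.integral_add intervalIntegrable_const hbI, intervalIntegral.integral_const,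
            intervalIntegral.integral_const_mul, integral_inv_sqrt_neg h12.le h2, smul_eq_mul]
          ring
      _ ≤ a * 1 + b * (2 * (1 - 0)) := by
          gcongr
          · linarith
          · rw [Real.sqrt_le_one]; linarith
          · exact Real.sqrt_nonneg _
      _ = a + 2 * b := by ring
  -- the initial energy
  have hE₁ : ∫ x, φ x * ‖W τ₁ x‖ ^ 2 ≤ A * 3 := by
    have h1 : ∀ x, |φ x| ≤ 1 := fun x => by
      rw [abs_of_nonneg (cutoff_nonneg 1 x)]; exact cutoff_le_one 1 x
    have h := integral_mul_norm_sq_le_of_tsupport hφs h1 (hW.contDiff_slice (h12.trans h2)).continuous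
    have e : (fun x => |φ x| * ‖W τ₁ x‖ ^ 2) = fun x => φ x * ‖W τ₁ x‖ ^ 2 := by
      funext x; rw [abs_of_nonneg (cutoff_nonneg 1 x)]
    rw [e, one_mul] at h
    exact h.trans (hgr τ₁ (h12.trans h2) 0 3 (by norm_num))
  have hE₂ : 0 ≤ ∫ x, φ x * ‖W τ₂ x‖ ^ 2 := integral_nonneg fun x => mul_nonneg (cutoff_nonneg 1 x) (sq_nonneg _)
  -- the dissipation
  have hdiss : ∫ s in τ₁..τ₂, ∫ x, frobeniusNormSq (fderiv ℝ (W s) x) * φ x ≤ (A * 3 + (a + 2 * b)) / 2 := by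
    have h2one : (2 : ℝ) * 1 = 2 := by norm_num
    rw [h2one] at hid
    linarith [hid, hint_le, hE₁, hE₂]
  -- conclusion
  refine hdiss.trans ?_
  rw [ha, hb]
  set S : ℝ := A + K * A + A * Real.sqrt A with hS
  have hKA0 : 0 ≤ K * A := mul_nonneg hK0 hA0
  have hAsA0 : 0 ≤ A * Real.sqrt A := mul_nonneg hA0 hsA0
  have hAA : A * Real.sqrt A ≤ S := by rw [hS]; linarith
  have hKA : K * A ≤ S := by rw [hS]; linarith
  have hA1 : A ≤ S := by rw [hS]; linarith
  have i1 : 3 * C₂ * A ≤ 3 * C₂ * S := mul_le_mul_of_nonneg_left hA1 (by positivity)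
  have i2 : 2 * (C_P * C₁ * (A * Real.sqrt A)) ≤ 2 * C_P * C₁ * S := by
    have := mul_le_mul_of_nonneg_left hAA (by positivity : 0 ≤ 2 * C_P * C₁)
    linarith [this]
  have i3 : 2 * ((3 * C₁ + 2 * (C_P * C₁)) * (K * A)) ≤ 2 * (3 * C₁ + 2 * C_P * C₁) * S := by
    have := mul_le_mul_of_nonneg_left hKA (by positivity : 0 ≤ 2 * (3 * C₁ + 2 * C_P * C₁))
    linarith [this]
  have i4 : A * 3 ≤ 3 * S := by linarith
  have e : (3 + 3 * C₂ + 2 * C_P * C₁ + 2 * (3 * C₁ + 2 * C_P * C₁)) / 2 * S =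
      (3 * S + 3 * C₂ * S + 2 * C_P * C₁ * S + 2 * (3 * C₁ + 2 * C_P * C₁) * S) / 2 := by ring
  rw [e]
  linarith


/-- **The dissipation budget of the unit parabolic cylinder**: with the constant of `unitCylinder_dissipationIntegral_le`,
`dissMeasure W ([τ₁,τ₂] × B(0,1)) ≤ C_u (A + KA + A√A)` for `τ₁ < τ₂ < 0`, `−τ₁ ≤ 1` (`dissMeasure_le_ofReal_integral` with `χ₁`).
[cite: CaffarelliKohnNirenberg1982, §2 (2.5)] -/
theorem dissipation_unitCylinder_le :
    ∃ C_u : ℝ, 0 ≤ C_u ∧ ∀ (K A : ℝ) (W : ℝ → EuclideanSpace ℝ (Fin 3) → EuclideanSpace ℝ (Fin 3)),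
      IsTypeIAncientMild K W → HasLinGrowthAllTime A W →
      ∀ τ₁ τ₂ : ℝ, τ₁ < τ₂ → τ₂ < 0 → -τ₁ ≤ 1 →
        dissMeasure W (Icc τ₁ τ₂ ×ˢ ball (0 : EuclideanSpace ℝ (Fin 3)) 1) ≤
          ENNReal.ofReal (C_u * (A + K * A + A * Real.sqrt A)) := by
  obtain ⟨C_u, hC0, hC⟩ := unitCylinder_dissipationIntegral_le
  refine ⟨C_u, hC0, fun K A W hW hgr τ₁ τ₂ h12 h2 h1 => ?_⟩
  refine (dissMeasure_le_ofReal_integral hW h12 h2 0 1 (contDiff_cutoff (n := 0) 1).continuous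
    (hasCompactSupport_cutoff one_pos) (cutoff_nonneg 1) fun w hw => ?_).trans
    (ENNReal.ofReal_le_ofReal (hC K A W hW hgr τ₁ τ₂ h12 h2 h1))
  exact cutoff_eq_one one_pos (mem_ball_zero_iff.1 hw).le

end NearExtremalTransiencePerFlow.DissipationLedger

end Summit.NavierStokesRegularity.NavierStokesRegularity.Theorems

end
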